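import Mathlib

/-!
# Door D7 — the peaked extension lemma (Lemma P(ii) of the seat's sharpest statement, kernel form)

Solo seat `solo-MatrixMultiplication-informed`, gen 10.  In a mixed system whose largest digit `M`
exceeds the sum of all other digits ("peaked"), multiplicative dissociativity reduces to the system
without `M`: the new generator `u` (`X^M` or `X^s + X^M`) has degree larger than every product of the
remaining generators, so a relation `G + u·H = 0` with `G, H` in their span forces `H = 0` by
degree.  This file proves the abstract statement: a linearly independent family of polynomials of
degree `≤ B`, doubled by multiplication with any polynomial of degree `> B`, stays linearly
independent (`linearIndependent_sum_elim_mul_of_natDegree_lt`).  Consequently a minimal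
counterexample to multiplicative dissociativity (hence to D7-closure along this line) is FLAT:
its largest digit is at most the sum of the others.
-/

set_option linter.dupNamespace false

namespace Summit.MatrixMultiplication.MatrixMultiplication.Theorems

open Polynomial

/-- Elements of the span of a family of polynomials of degree `≤ B` have degree `≤ B`. [folklore] -/
theorem span_le_degreeLE_of_natDegree_le {K : Type*} [Field K] {ι : Type*} (w : ι → K[X]) (B : ℕ)
    (hdeg : ∀ i, (w i).natDegree ≤ B) :
    Submodule.span K (Set.range w) ≤ Polynomial.degreeLE K B := by
  rw [Submodule.span_le]
  rintro _ ⟨i, rfl⟩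
  exact Polynomial.mem_degreeLE.2 (natDegree_le_iff_degree_le.1 (hdeg i))

/-- **Peaked extension.** If `w` is a linearly independent family of polynomials of degree `≤ B`
over a field and `u` is a polynomial of degree `> B`, then the doubled family `w ⊔ u·w` is linearly
independent: in a relation `G + u·H = 0` with `G, H ∈ span w`, `deg (u·H) > B ≥ deg G` unless
`H = 0`. [new; seat solo-informed, door D7, Lemma P(ii)] -/
theorem linearIndependent_sum_elim_mul_of_natDegree_lt {K : Type*} [Field K] {ι : Type*}
    (w : ι → K[X]) (hw : LinearIndependent K w) (B : ℕ) (hdeg : ∀ i, (w i).natDegree ≤ B)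
    (u : K[X]) (hu : B < u.natDegree) :
    LinearIndependent K (Sum.elim w (fun i => u * w i)) := by
  classical
  have hu0 : u ≠ 0 := by
    rintro rfl
    simp at hu
  have hspan := span_le_degreeLE_of_natDegree_le w B hdeg
  rw [linearIndependent_sum, Sum.elim_comp_inl, Sum.elim_comp_inr]
  refine ⟨hw, ?_, ?_⟩
  · -- multiplication by `u ≠ 0` is an injective linear map
    have hcomp : (fun i => u * w i) = (LinearMap.mulLeft K u) ∘ w := by
      funext i
      simp [LinearMap.mulLeft_apply]
    rw [hcomp]
    refine hw.map' _ ?_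
    rw [LinearMap.ker_eq_bot]
    intro a b hab
    simp only [LinearMap.mulLeft_apply] at hab
    exact mul_left_cancel₀ hu0 hab
  · -- the two spans meet only in `0`, by degree
    rw [Submodule.disjoint_def]
    intro G hG1 hG2
    have hGdeg : G.degree ≤ B := Polynomial.mem_degreeLE.1 (hspan hG1)
    have hrange : Set.range (fun i => u * w i) = (LinearMap.mulLeft K u) '' Set.range w := by
      ext x
      simp only [Set.mem_range, Set.mem_image, LinearMap.mulLeft_apply, exists_exists_eq_and]
    rw [hrange, ← Submodule.map_span] at hG2
    obtain ⟨P, hP, hPG⟩ := Submodule.mem_map.1 hG2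
    simp only [LinearMap.mulLeft_apply] at hPG
    have hPdeg : P.degree ≤ B := Polynomial.mem_degreeLE.1 (hspan hP)
    by_contra hne
    have hP0 : P ≠ 0 := by
      rintro rfl
      simp at hPG
      exact hne hPG.symm
    have h1 : (u * P).natDegree = u.natDegree + P.natDegree := Polynomial.natDegree_mul hu0 hP0
    have h2 : (u * P).natDegree ≤ B := by
      rw [hPG]
      exact natDegree_le_iff_degree_le.2 hGdeg
    omega

end Summit.MatrixMultiplication.MatrixMultiplication.Theorems
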